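import Summits.NavierStokesRegularity.NavierStokesRegularity.Theorems.WakeRatchetEternalInviscidRateLeakRatchet

/-!
# Conveyor ledger (crux `WakeRatchet.EternalInviscidRate`, ⟨stmt-NavierStokesRegularity-25646⟩) —
# registered stub `stub_noConveyor` of the skeleton of record (LINE g10-3, sha16 d183ebc25b56) CLOSED BY NAME

The skeleton «conveyor ledger» (`conveyor_ledger_line.lean`, sha16 `d183ebc25b56`, namespace
`…Cruxes.EternalInviscidRate.FinalWakeLedger`) composes the crux `EternalInviscidRate` from five stubs; `stub_wakeLimit` and `stub_tailLimit`
are landed (p681703, p681727).  This file closes the third, `stub_noConveyor : ∀ R : ℝ, 1 ≤ R → NoConveyor R`, with the definition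
`NoConveyor` repeated VERBATIM from the skeleton (same namespace, same text) and the proof supplied by the landed LEAK RATCHET
(`noConveyor_all`, …LeakRatchet, p817248): for EVERY uniformly bounded admissible inviscid eternal solution of a cancelling table the tail
envelope obeys `Θ_{n+1} ≤ (1 − e^{−2C_AΛ⁻¹M})·Θ_n` (deficit functional `(Θ − T_{n+1})·e^{∫2C_AΛ⁻¹‖W_{n+1}‖}` non-decreasing; finite
action), so the conveyor mass `m ≤ L(n+j) ≤ (1 − e^{−cM})^j Θ_n → 0` vanishes and every final tail is the sum of the final wakes above it.
No smallness of `ε₀` is needed (`εs := 1`); of `InTableClass R α` only the cancellation (4.3) is used.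
HONEST LABEL: one registered stub of one line on one crux; the crux `EternalInviscidRate`, the stubs `stub_noSloshing` / `stub_wakeFloor`, and
every NS statement remain OPEN.  MODEL lattice only (Tao 2016 §4 renormalised cascade); nothing here bears on the summit.
[cite: Tao2016AveragedNS, §4 Lemma 4.1 (4.8)–(4.10) with the cancellation (4.3), in the self-similar variables of §6.4]
-/

noncomputable section

set_option linter.dupNamespace false

open Filter Topology
open Literature.Analysis.FluidPDE.TaoCascade

namespace Summit.NavierStokesRegularity.NavierStokesRegularity.Cruxes.EternalInviscidRate.FinalWakeLedger

/-- NO CONVEYOR MASS: the final tail above every shell equals the sum of the final wakes above it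
(no energy escapes to shell index `+∞` at the blow-up time).  Final wakes `ω` and final tails `T` are
SUPPLIED BY HYPOTHESIS (junk-free).  (Verbatim from the skeleton of record `conveyor_ledger_line.lean`, sha16 d183ebc25b56.)
[cite: Tao2016AveragedNS, §4 Lemma 4.1 (4.8)–(4.10), §6.4; cell vocabulary (LINE g10-3 «conveyor ledger»)] -/
def NoConveyor (R : ℝ) : Prop :=
  ∃ εs : ℝ, 0 < εs ∧ ∀ ε₀ : ℝ, 0 < ε₀ → ε₀ ≤ εs →
    ∀ α : Fin 4 → Fin 4 → Fin 4 → ℤ × ℤ × ℤ → ℝ, InTableClass R α →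
    ∀ W : ℤ → ℝ → Em 4, IsEternal ε₀ α W → UniformBound W →
    ∀ ω : ℤ → ℝ, (∀ k : ℤ, Tendsto (physEnergy ε₀ W k) atTop (𝓝 (ω k))) →
    ∀ T : ℤ → ℝ, (∀ n : ℤ, Tendsto (fun σ => ∑' k : ℕ, physEnergy ε₀ W (n + k) σ) atTop (𝓝 (T n))) →
    ∀ n : ℤ, T n = ∑' k : ℕ, ω (n + k)

/-- **Registered stub `stub_noConveyor` (LINE g10-3 «conveyor ledger», skeleton d183ebc25b56), signature verbatim — PROVED.**
NO CONVEYOR MASS on `E₂(R)`, for every `R ≥ 1` and in fact every `ε₀ > 0` (`εs := 1`): by the leak ratchet `noConveyor_all`.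
[cite: Tao2016AveragedNS, §4 Lemma 4.1 (4.8)–(4.10) with the cancellation (4.3), §6.4] -/
theorem stub_noConveyor : ∀ R : ℝ, 1 ≤ R → NoConveyor R := by
  intro R _hR
  refine ⟨1, one_pos, ?_⟩
  intro ε₀ hε₀ _hle α hα W hW hU ω hω T hT n
  exact noConveyor_all hε₀ hα.2.1 hW hU hω hT n

end Summit.NavierStokesRegularity.NavierStokesRegularity.Cruxes.EternalInviscidRate.FinalWakeLedger

end
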